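import Mathlib
import HarnessLib

/-!
# Stub B of line `gauge_qbp_far_seam`, assembly part C: asymptotics of the uniform bound

Third assembly file for stub B `stub_farCutCurrent_of_clustering` of line `gauge_qbp_far_seam` (route `TcThermcert1`,
items `stmt-Ventures-24560` / `stmt-Ventures-26381`); pure real analysis, no lattice objects. With the collar radius
`r = ⌊L/4⌋`, the Lieb–Robinson cut-off `T_L = (⌊L/4⌋-2)/(88 e J₂)` (`J₂ = 2 + |U| + 2·(1/2)`), the clustering distance
`⌊L/2⌋ - 1 - ⌊L/4⌋` and the flux-window size `v = 4Lθ`, the `φ`-independent per-bond bound `B̄(L, θ)` of part D satisfies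
`L · B̄(L, θ) ≤ K_A L^{2k+1} e^{-L/(8ξ)} + K_B L^{12} e^{-L/16} + K_C L² e^{-πL/(704 e J₂ β)}` for `L ≥ 8` as soon as
`12βθ` is at most half of each of the three decay rates `1/(4ξ)` (clustering), `1/8` (Lieb–Robinson leakage), `π/(352 e J₂ β)`
(tail of the QBP weight) (`mul_uniformBound_le`); and `K L^m e^{-κL} → 0` (`tendsto_const_mul_pow_mul_exp_neg`).
Integer bookkeeping (`collar_arith`): `L/4 - 11/4 ≤ ⌊L/4⌋ - 2 ≤ L`, `L/4 - 3/2 ≤ ⌊L/2⌋ - 1 - ⌊L/4⌋` for `L ≥ 8`.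
SC in the Hubbard model is NOT proved by anything in this file; K1′/K1 are stiffness CEILINGS conditional on the bet C8.
-/

noncomputable section

open Filter Topology Set Real Finset

namespace Summit.Ventures.CertifiedManyBodySolver.Theorems.TcThermcert1.GaugeQbpFarSeam

/-! ## §4 Asymptotics of the uniform bound -/

section Asymptotics

/-- `K · L^m · e^{-κL} → 0` along the naturals (`κ > 0`). [folklore] -/
theorem tendsto_const_mul_pow_mul_exp_neg (K : ℝ) (m : ℕ) {κ : ℝ} (hκ : 0 < κ) :
    Tendsto (fun L : ℕ => K * (L : ℝ) ^ m * Real.exp (-(κ * L))) atTop (𝓝 0) := by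
  have h1 := (Real.tendsto_pow_mul_exp_neg_atTop_nhds_zero m).comp
    (tendsto_natCast_atTop_atTop.const_mul_atTop hκ)
  have h2 := h1.const_mul (K / κ ^ m)
  rw [mul_zero] at h2
  refine h2.congr' (Eventually.of_forall fun L => ?_)
  have hκ0 : κ ^ m ≠ 0 := pow_ne_zero _ hκ.ne'
  simp only [Function.comp_apply]
  rw [mul_pow]
  field_simp

variable (L : ℕ) [NeZero L]

omit [NeZero L] in
/-- Integer bookkeeping of the collar radius `⌊L/4⌋`, the cut-off numerator `⌊L/4⌋ - 2` and the distance
`⌊L/2⌋ - 1 - ⌊L/4⌋`, for `L ≥ 8`. [folklore] -/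
theorem collar_arith (hL : 8 ≤ L) :
    (L : ℝ) / 4 - 11 / 4 ≤ ((L / 4 - 2 : ℕ) : ℝ) ∧ ((L / 4 - 2 : ℕ) : ℝ) ≤ L ∧
      (L : ℝ) / 4 - 3 / 2 ≤ ((L / 2 - 1 - L / 4 : ℕ) : ℝ) := by
  have h1 : L ≤ 4 * (L / 4 - 2) + 11 := by omega
  have h2 : L / 4 - 2 ≤ L := by omega
  have h3 : L ≤ 4 * (L / 2 - 1 - L / 4) + 6 := by omega
  have h1' : (L : ℝ) ≤ 4 * ((L / 4 - 2 : ℕ) : ℝ) + 11 := by exact_mod_cast h1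
  have h2' : ((L / 4 - 2 : ℕ) : ℝ) ≤ L := by exact_mod_cast h2
  have h3' : (L : ℝ) ≤ 4 * ((L / 2 - 1 - L / 4 : ℕ) : ℝ) + 6 := by exact_mod_cast h3
  refine ⟨by linarith, h2', by linarith⟩

omit [NeZero L] in
/-- **The explicit majorant.** For `L ≥ 8` and a flux window `θ ≤ 1/2` with `12βθ` at most half of each decay rate
(`1/(8ξ)` clustering, `1/16` Lieb–Robinson, `π/(704 e J₂ β)` weight tail), `L · B̄(L, θ)` is bounded by
`K_A L^{2k+1} e^{-L/(8ξ)} + K_B L^{12} e^{-L/16} + K_C L^2 e^{-πL/(704 e J₂ β)}`. [folklore] -/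
theorem mul_uniformBound_le (hL : 8 ≤ L) {β ξ θ U C : ℝ} {k : ℕ} (hβ : 0 < β) (hξ : 0 < ξ) (hθ0 : 0 ≤ θ)
    (hθ2 : θ ≤ 1 / 2) (hθξ : 12 * β * θ ≤ 1 / (8 * ξ)) (hθβ : 12 * β * θ ≤ 1 / 16)
    (hθU : 12 * β * θ ≤ π / (704 * Real.exp 1 * (2 + |U| + 2 * (1 / 2 : ℝ)) * β)) :
    (L : ℝ) * (Real.exp (β * (4 * L * θ)) *
        (max C 0 * Real.exp (β * (4 * L * θ)) * ((L : ℝ) ^ 2) ^ k *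
            Real.exp (-((L / 2 - 1 - L / 4 : ℕ) : ℝ) / ξ) +
          4 * Real.exp (β / 2 * (4 * L * θ)) *
            (β / 2 *
                (((4 * (L : ℝ) ^ 4) *
                    (2 * (4 * L * θ) *
                      ((4 * (L : ℝ) ^ 4) *
                        (2 * (2 + |U| + 2 * (1 / 2 : ℝ)) * (2 + |U| + 2 * (1 / 2 : ℝ)) *
                            (((L / 4 - 2 : ℕ) : ℝ) / (88 * Real.exp 1 * (2 + |U| + 2 * (1 / 2 : ℝ)))) *
                          Real.exp (-((L / 4 - 2 : ℕ) : ℝ) / 2)))) *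
                    (((L / 4 - 2 : ℕ) : ℝ) / (88 * Real.exp 1 * (2 + |U| + 2 * (1 / 2 : ℝ))))) +
                  2 * (4 * L * θ) *
                    Real.exp (-(π / β * (((L / 4 - 2 : ℕ) : ℝ) / (88 * Real.exp 1 * (2 + |U| + 2 * (1 / 2 : ℝ))))))) *
              Real.exp (β * (4 * L * θ))) *
            4)) ≤
      max C 0 * Real.exp (3 / (2 * ξ)) * (L : ℝ) ^ (2 * k + 1) * Real.exp (-(1 / (8 * ξ) * L)) +
        1024 * β * (2 + |U| + 2 * (1 / 2 : ℝ)) ^ 2 * Real.exp (11 / 8) * (L : ℝ) ^ 12 * Real.exp (-(1 / 16 * L)) +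
        32 * β * Real.exp (11 * π / (352 * Real.exp 1 * (2 + |U| + 2 * (1 / 2 : ℝ)) * β)) * (L : ℝ) ^ 2 *
          Real.exp (-(π / (704 * Real.exp 1 * (2 + |U| + 2 * (1 / 2 : ℝ)) * β) * L)) := by
  obtain ⟨hmlo, hmhi, hddlo⟩ := collar_arith L hL
  -- abbreviate the integer quantities
  generalize hm : ((L / 4 - 2 : ℕ) : ℝ) = m at hmlo hmhi ⊢
  generalize hdd : ((L / 2 - 1 - L / 4 : ℕ) : ℝ) = dd at hddlo ⊢
  have hL8 : (8 : ℝ) ≤ L := by exact_mod_cast hL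
  have hL0 : (0 : ℝ) ≤ L := by linarith
  have hL1 : (1 : ℝ) ≤ L := by linarith
  have hm0 : 0 ≤ m := by rw [← hm]; exact Nat.cast_nonneg _
  have hJ3 : (3 : ℝ) ≤ (2 + |U| + 2 * (1 / 2 : ℝ)) := by have := abs_nonneg U; linarith
  have hJ0 : (0 : ℝ) < (2 + |U| + 2 * (1 / 2 : ℝ)) := by linarith
  have he1 : (1 : ℝ) ≤ Real.exp 1 := Real.one_le_exp_iff.2 zero_le_one |>.trans' le_rfl
  have hden : (1 : ℝ) ≤ 88 * Real.exp 1 * (2 + |U| + 2 * (1 / 2 : ℝ)) := by nlinarith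
  have hden0 : (0 : ℝ) < 88 * Real.exp 1 * (2 + |U| + 2 * (1 / 2 : ℝ)) := by linarith
  -- the cut-off
  have hT0 : 0 ≤ m / (88 * Real.exp 1 * (2 + |U| + 2 * (1 / 2 : ℝ))) := div_nonneg hm0 hden0.le
  have hThi : m / (88 * Real.exp 1 * (2 + |U| + 2 * (1 / 2 : ℝ))) ≤ L := (div_le_self hm0 hden).trans hmhi
  have hTlo : ((L : ℝ) - 11) / (352 * Real.exp 1 * (2 + |U| + 2 * (1 / 2 : ℝ))) ≤ m / (88 * Real.exp 1 * (2 + |U|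
      + 2 * (1 / 2 : ℝ))) := by
    rw [div_le_div_iff₀ (by positivity) hden0]
    nlinarith
  -- sizes of v = 4Lθ and the three exponential factors
  have hv0 : 0 ≤ 4 * (L : ℝ) * θ := by positivity
  have hv2 : 4 * (L : ℝ) * θ ≤ 2 * L := by nlinarith
  have hEE : Real.exp (β * (4 * L * θ)) * Real.exp (β * (4 * L * θ)) ≤ Real.exp (12 * β * θ * L) := by
    rw [← Real.exp_add]
    exact Real.exp_le_exp.2 (by nlinarith [mul_nonneg (mul_nonneg hβ.le hθ0) hL0])
  have hEEE : Real.exp (β * (4 * L * θ)) * Real.exp (β / 2 * (4 * L * θ)) * Real.exp (β * (4 * L * θ)) ≤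
      Real.exp (12 * β * θ * L) := by
    rw [← Real.exp_add, ← Real.exp_add]
    exact Real.exp_le_exp.2 (by nlinarith [mul_nonneg (mul_nonneg hβ.le hθ0) hL0])
  have hgrow : 12 * β * θ * L ≤ 1 / (8 * ξ) * L ∧ 12 * β * θ * L ≤ 1 / 16 * L ∧
      12 * β * θ * L ≤ π / (704 * Real.exp 1 * (2 + |U| + 2 * (1 / 2 : ℝ)) * β) * L :=
    ⟨mul_le_mul_of_nonneg_right hθξ hL0, mul_le_mul_of_nonneg_right hθβ hL0, mul_le_mul_of_nonneg_right hθU hL0⟩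
  have hexpA : Real.exp (12 * β * θ * L) * Real.exp (-dd / ξ) ≤
      Real.exp (3 / (2 * ξ)) * Real.exp (-(1 / (8 * ξ) * L)) := by
    rw [← Real.exp_add, ← Real.exp_add]
    refine Real.exp_le_exp.2 ?_
    have h1 : ((L : ℝ) / 4 - 3 / 2) / ξ ≤ dd / ξ := div_le_div_of_nonneg_right hddlo hξ.le
    have h2 : ((L : ℝ) / 4 - 3 / 2) / ξ = 2 * (1 / (8 * ξ) * L) - 3 / (2 * ξ) := by
      field_simp; ring
    rw [neg_div]
    linarith [hgrow.1]
  have hexpB : Real.exp (12 * β * θ * L) * Real.exp (-m / 2) ≤ Real.exp (11 / 8) * Real.exp (-(1 / 16 * L)) := by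
    rw [← Real.exp_add, ← Real.exp_add]
    refine Real.exp_le_exp.2 ?_
    rw [neg_div]
    linarith [hgrow.2.1]
  have hexpC : Real.exp (12 * β * θ * L) * Real.exp (-(π / β * (m / (88 * Real.exp 1 * (2 + |U| + 2
      * (1 / 2 : ℝ)))))) ≤
      Real.exp (11 * π / (352 * Real.exp 1 * (2 + |U| + 2 * (1 / 2 : ℝ)) * β)) *
        Real.exp (-(π / (704 * Real.exp 1 * (2 + |U| + 2 * (1 / 2 : ℝ)) * β) * L)) := by
    rw [← Real.exp_add, ← Real.exp_add]
    refine Real.exp_le_exp.2 ?_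
    have h1 : π / β * (((L : ℝ) - 11) / (352 * Real.exp 1 * (2 + |U| + 2 * (1 / 2 : ℝ)))) ≤ π / β * (m / (88
        * Real.exp 1 * (2 + |U| + 2 * (1 / 2 : ℝ)))) :=
      mul_le_mul_of_nonneg_left hTlo (by positivity)
    have h2 : π / β * (((L : ℝ) - 11) / (352 * Real.exp 1 * (2 + |U| + 2 * (1 / 2 : ℝ)))) =
        2 * (π / (704 * Real.exp 1 * (2 + |U| + 2 * (1 / 2 : ℝ)) * β) * L) - 11 * π / (352 * Real.exp 1 * (2 + |U|
            + 2 * (1 / 2 : ℝ)) * β) := by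
      field_simp; ring
    linarith [hgrow.2.2]
  -- the leakage size ε̄ ≤ 128 J₂² L¹¹ e^{-m/2}
  have hεbar : (4 * (L : ℝ) ^ 4) * (2 * (4 * L * θ) * ((4 * (L : ℝ) ^ 4) * (2 * (2 + |U| + 2 * (1 / 2 : ℝ)) * (2
      + |U| + 2 * (1 / 2 : ℝ)) * (m / (88 * Real.exp 1 * (2 + |U| + 2 * (1 / 2 : ℝ)))) *
      Real.exp (-m / 2)))) * (m / (88 * Real.exp 1 * (2 + |U| + 2 * (1 / 2 : ℝ)))) ≤
      128 * (2 + |U| + 2 * (1 / 2 : ℝ)) ^ 2 * (L : ℝ) ^ 11 * Real.exp (-m / 2) := by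
    have hTT : m / (88 * Real.exp 1 * (2 + |U| + 2 * (1 / 2 : ℝ))) * (m / (88 * Real.exp 1 * (2 + |U| + 2
        * (1 / 2 : ℝ)))) ≤ (L : ℝ) * L :=
      mul_le_mul hThi hThi hT0 hL0
    calc (4 * (L : ℝ) ^ 4) * (2 * (4 * L * θ) * ((4 * (L : ℝ) ^ 4) * (2 * (2 + |U| + 2 * (1 / 2 : ℝ)) * (2 + |U|
        + 2 * (1 / 2 : ℝ)) * (m / (88 * Real.exp 1 * (2 + |U| + 2 * (1 / 2 : ℝ)))) *
          Real.exp (-m / 2)))) * (m / (88 * Real.exp 1 * (2 + |U| + 2 * (1 / 2 : ℝ))))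
        = 4 * ((4 * (L : ℝ) ^ 4) * (4 * (L : ℝ) ^ 4)) * (4 * L * θ) * (2 + |U| + 2 * (1 / 2 : ℝ)) ^ 2 *
            (m / (88 * Real.exp 1 * (2 + |U| + 2 * (1 / 2 : ℝ))) * (m / (88 * Real.exp 1 * (2 + |U| + 2
                * (1 / 2 : ℝ))))) * Real.exp (-m / 2) := by ring
      _ ≤ 4 * ((4 * (L : ℝ) ^ 4) * (4 * (L : ℝ) ^ 4)) * (2 * L) * (2 + |U| + 2 * (1 / 2 : ℝ)) ^ 2 * ((L : ℝ) * L) *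
            Real.exp (-m / 2) := by gcongr
      _ = 128 * (2 + |U| + 2 * (1 / 2 : ℝ)) ^ 2 * (L : ℝ) ^ 11 * Real.exp (-m / 2) := by ring
  -- split `L · B̄` into the three terms and bound each
  have hsplit : (L : ℝ) * (Real.exp (β * (4 * L * θ)) *
        (max C 0 * Real.exp (β * (4 * L * θ)) * ((L : ℝ) ^ 2) ^ k *
            Real.exp (-dd / ξ) +
          4 * Real.exp (β / 2 * (4 * L * θ)) *
            (β / 2 *
                (((4 * (L : ℝ) ^ 4) *
                    (2 * (4 * L * θ) *
                      ((4 * (L : ℝ) ^ 4) *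
                        (2 * (2 + |U| + 2 * (1 / 2 : ℝ)) * (2 + |U| + 2 * (1 / 2 : ℝ)) *
                            (m / (88 * Real.exp 1 * (2 + |U| + 2 * (1 / 2 : ℝ)))) *
                          Real.exp (-m / 2)))) *
                    (m / (88 * Real.exp 1 * (2 + |U| + 2 * (1 / 2 : ℝ))))) +
                  2 * (4 * L * θ) *
                    Real.exp (-(π / β * (m / (88 * Real.exp 1 * (2 + |U| + 2 * (1 / 2 : ℝ))))))) *
              Real.exp (β * (4 * L * θ))) *
            4)) =
      max C 0 * ((L : ℝ) * ((L : ℝ) ^ 2) ^ k) *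
          (Real.exp (β * (4 * L * θ)) * Real.exp (β * (4 * L * θ))) * Real.exp (-dd / ξ) +
        8 * β * L * (Real.exp (β * (4 * L * θ)) * Real.exp (β / 2 * (4 * L * θ)) * Real.exp (β * (4 * L * θ))) *
          ((4 * (L : ℝ) ^ 4) * (2 * (4 * L * θ) * ((4 * (L : ℝ) ^ 4) * (2 * (2 + |U| + 2 * (1 / 2 : ℝ)) * (2 + |U|
              + 2 * (1 / 2 : ℝ)) * (m / (88 * Real.exp 1 * (2 + |U| + 2 * (1 / 2 : ℝ)))) *
            Real.exp (-m / 2)))) * (m / (88 * Real.exp 1 * (2 + |U| + 2 * (1 / 2 : ℝ))))) +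
        16 * β * L * (4 * L * θ) *
          (Real.exp (β * (4 * L * θ)) * Real.exp (β / 2 * (4 * L * θ)) * Real.exp (β * (4 * L * θ))) *
          Real.exp (-(π / β * (m / (88 * Real.exp 1 * (2 + |U| + 2 * (1 / 2 : ℝ)))))) := by ring
  rw [hsplit]
  have hC0 : 0 ≤ max C 0 := le_max_right _ _
  have hLk : (L : ℝ) * ((L : ℝ) ^ 2) ^ k = (L : ℝ) ^ (2 * k + 1) := by rw [← pow_mul, pow_succ, mul_comm]
  refine add_le_add (add_le_add ?_ ?_) ?_
  · -- clustering term
    calc max C 0 * ((L : ℝ) * ((L : ℝ) ^ 2) ^ k) *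
          (Real.exp (β * (4 * L * θ)) * Real.exp (β * (4 * L * θ))) * Real.exp (-dd / ξ)
        ≤ max C 0 * ((L : ℝ) * ((L : ℝ) ^ 2) ^ k) * Real.exp (12 * β * θ * L) * Real.exp (-dd / ξ) := by gcongr
      _ = max C 0 * (L : ℝ) ^ (2 * k + 1) * (Real.exp (12 * β * θ * L) * Real.exp (-dd / ξ)) := by rw [hLk]; ring
      _ ≤ max C 0 * (L : ℝ) ^ (2 * k + 1) * (Real.exp (3 / (2 * ξ)) * Real.exp (-(1 / (8 * ξ) * L))) := by gcongr
      _ = _ := by ring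
  · -- Lieb–Robinson leakage term
    calc 8 * β * L * (Real.exp (β * (4 * L * θ)) * Real.exp (β / 2 * (4 * L * θ)) * Real.exp (β * (4 * L * θ))) *
          ((4 * (L : ℝ) ^ 4) * (2 * (4 * L * θ) * ((4 * (L : ℝ) ^ 4) * (2 * (2 + |U| + 2 * (1 / 2 : ℝ)) * (2 + |U|
              + 2 * (1 / 2 : ℝ)) * (m / (88 * Real.exp 1 * (2 + |U| + 2 * (1 / 2 : ℝ)))) *
            Real.exp (-m / 2)))) * (m / (88 * Real.exp 1 * (2 + |U| + 2 * (1 / 2 : ℝ)))))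
        ≤ 8 * β * L * Real.exp (12 * β * θ * L) * (128 * (2 + |U| + 2 * (1 / 2 : ℝ)) ^ 2 * (L : ℝ) ^ 11
            * Real.exp (-m / 2)) := by
          gcongr
      _ = 1024 * β * (2 + |U| + 2 * (1 / 2 : ℝ)) ^ 2 * (L : ℝ) ^ 12 * (Real.exp (12 * β * θ * L)
          * Real.exp (-m / 2)) := by ring
      _ ≤ 1024 * β * (2 + |U| + 2 * (1 / 2 : ℝ)) ^ 2 * (L : ℝ) ^ 12 * (Real.exp (11 / 8) * Real.exp (-(1 / 16
          * L))) := by gcongr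
      _ = _ := by ring
  · -- weight-tail term
    calc 16 * β * L * (4 * L * θ) *
          (Real.exp (β * (4 * L * θ)) * Real.exp (β / 2 * (4 * L * θ)) * Real.exp (β * (4 * L * θ))) *
          Real.exp (-(π / β * (m / (88 * Real.exp 1 * (2 + |U| + 2 * (1 / 2 : ℝ))))))
        ≤ 16 * β * L * (2 * L) * Real.exp (12 * β * θ * L) *
          Real.exp (-(π / β * (m / (88 * Real.exp 1 * (2 + |U| + 2 * (1 / 2 : ℝ)))))) := by gcongr
      _ = 32 * β * (L : ℝ) ^ 2 *
          (Real.exp (12 * β * θ * L) * Real.exp (-(π / β * (m / (88 * Real.exp 1 * (2 + |U| + 2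
              * (1 / 2 : ℝ))))))) := by ring
      _ ≤ 32 * β * (L : ℝ) ^ 2 * (Real.exp (11 * π / (352 * Real.exp 1 * (2 + |U| + 2 * (1 / 2 : ℝ)) * β)) *
          Real.exp (-(π / (704 * Real.exp 1 * (2 + |U| + 2 * (1 / 2 : ℝ)) * β) * L))) := by gcongr
      _ = _ := by ring

end Asymptotics

end Summit.Ventures.CertifiedManyBodySolver.Theorems.TcThermcert1.GaugeQbpFarSeam

end
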